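/-
Copyright (c) 2026 the pub-hodgecm-mathlib formalisation cell (harness21).  Prover seat hodgecm-mathlib-K2E3-p06 (g2), Track B «K2-LIT» ∕ h413,
ENGINE E3 unit U4 «Keys», SIGS-TABLE row #6 `sig_K2E3IrregularReducibleCaseThree` — analytic letter hKP at the CM place (brick F6: transport to `L ⊗ L⁺_v`).
-/
import Summits.HodgeConjecture.HodgeConjecture.Theorems.K2E3KeysSkewLineNonvanishingLocal    -- ★ brick F5 (this seat): hKP on an abstract local field with involution
import Summits.HodgeConjecture.HodgeConjecture.Theorems.F0P3cStCharTSLocalRingNormDictionary   -- ★ DICT: `prod_normAbs_*`, `isUnit_*_localRing`, one place above `v`; brings `conjLocal_apply_eq_of_smul_eq`, `exists_conjLocal_skew_unit`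
import Literature.NumberTheory.Automorphic.AdeleAddCharLocalNontrivial                       -- ★ `adeleAddCharAt`, `isContinuousNontrivial_adeleAddCharAt`
import HarnessLib

/-!
# K2 · E3 · U4 «Keys», row #6 — brick F6: KEYS' PLANCHEREL NON-VANISHING AT A NON-SPLIT CM PLACE — the analytic letter hKP of ★ p855477 in its exact shape:
# `∫_{R⁻} (Π_{w'} |(1+η)_{w'}|)⁻¹ • χ₁(σ(1+η)^)⁻¹ dμ⁻ ≠ 0` on `R = ∏_{w ∣ v} L_w` for `χ₁` continuous, trivial on norms, non-trivial on a `σ`-fixed unit [Keys1984 §5, §7 Thm. (1)]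

Cell `pub/hodgecm-mathlib` (D-0151), HCML Track B «K2-LIT», crux H413 = `stmt-HodgeConjecture-24833` (lane `--supports … --as helper`), route
HCCMUnconditional; socket `sig_K2E3IrregularReducibleCaseThree` (U4-c) of `Cruxes/H413/Lines/K2_E3_EllipticInputsSigs_U4Keys.lean`.
THEOREMS ONLY (0 def ∕ 0 instance ∕ 0 notation ∕ 0 sorry); ★-only imports.

THE TRANSPORT (one place above `v`, ★ `PlacesOver.subsingleton_of_smul_eq`): `R = ∏_{w' ∣ v} L_{w'} ≃ L_w` by evaluation at the unique `w` (Mathlib `RingEquiv.piUnique` ∕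
`Homeomorph.piUnique`); under it `σ = c ⊗ 1` becomes `σ_w = galAdicCompletionMap c` (★ `conjLocal_apply_eq_of_smul_eq`), an involution (★ `conjLocal_conjLocal_cm`) and an isometry
(★ `prod_normAbs_conjLocal`); `R⁻ ≃ L_w⁻`, Haar measures correspond by push-forward; `χ₁` becomes the quasi-character `χ₁ ∘ Units.map e⁻¹` of `L_wˣ`; the additive character
is ★ `adeleAddCharAt L w`; and on `1 + R⁻ ⊆ Rˣ` (★ `isUnit_one_add_coe_skewPart`) the `dite` of ★ p855477 is `χ₁(σ b̂)⁻¹ = χ₁(b̂) = χ̃(e b)` (`χ₁` trivial on norms).  Then ★ F5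
`integral_skewLine_extend_ne_zero` is exactly hKP.
* **`skewLineIntegral_ne_zero`** — hKP, quantified as in the g0 probe `Probe_sig6_of_keysPlancherel` (every `[MeasurableSpace R] [BorelSpace R]`, every regular Haar `μ⁻` of `R⁻`).
HONEST LABEL: HC_CM is proved only modulo the 7 printed citations (2 remaining named inputs: hLiu418 = `stmt-HodgeConjecture-24832`, h413 =
`stmt-HodgeConjecture-24833`) until rung 0 closes; count-neutral (the socket itself is closed in `Theorems/K2E3IrregularReducibleCaseThree.lean`, brick F7).

## References
* [Keys1984] D. Keys, *Principal series representations of special unitary groups over local fields*, Compositio Math. 51 (1984), §5, §7 Thm. (1) p. 126.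
* [Rogawski1990] J. D. Rogawski, *Automorphic Representations of Unitary Groups in Three Variables*, Ann. of Math. Stud. 123 (1990), §1.9 p. 8, §12.2 (3) pp. 173–174.
* [CasselsFrohlichANT1967] J. W. S. Cassels, A. Fröhlich (eds.), *Algebraic Number Theory* (1967), Ch. II §10–§11 (`L ⊗_K K_v = ∏_{w∣v} L_w`), Ch. VII Prop. 1.2.
-/

set_option autoImplicit false
-- the mandated namespace has the single-problem summit's repeated segment (`HodgeConjecture.HodgeConjecture`)
set_option linter.dupNamespace false

noncomputable section

open NumberField IsDedekindDomain MeasureTheory Filter Set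
open scoped NNReal ENNReal Topology
open Literature.NumberTheory.Automorphic Literature.NumberTheory.Automorphic.UnitaryGroup Literature.NumberTheory.Automorphic.UnitaryGroup.HeisRing
open Literature.NumberTheory.Automorphic.TateDirect
open Literature.NumberTheory.GaloisRepresentations Literature.NumberTheory.GaloisRepresentations.IsNonarchimedeanLocalField
open Summit.HodgeConjecture.HodgeConjecture.Cruxes.H413.F0P3cStCharTSLocalRingNormDictionary
open Summit.HodgeConjecture.HodgeConjecture.Cruxes.H413.K2E3KeysSkewLineNonvanishingLocal

namespace Summit.HodgeConjecture.HodgeConjecture.Cruxes.H413.K2E3KeysSkewLineNonvanishingCM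

open scoped Classical in
set_option maxHeartbeats 1600000 in
set_option synthInstance.maxHeartbeats 400000 in
-- transport-heavy: two topological-ring structures (`∏_{w ∣ v} L_w` and `L_w`), their unit groups, skew parts and Haar measures
/-- **KEYS' PLANCHEREL NON-VANISHING AT A NON-SPLIT CM PLACE (the analytic letter hKP of row #6).**  For a CM field `L`, a finite place `v` of `L⁺` NON-SPLIT in `L`,
`R = ∏_{w ∣ v} L_w` with `σ = c ⊗ 1`, and a continuous character `χ₁ : Rˣ → ℂˣ` TRIVIAL ON NORMS (`χ₁(σα · α) = 1`) and NON-TRIVIAL ON SOME `σ`-FIXED UNIT: for every Borel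
structure and every regular Haar measure `μ⁻` of the skew line `R⁻ = {σ η = −η}`,
`∫_{R⁻} (Π_{w'∣v} |(1+η)_{w'}|_{w'})⁻¹ • h(1+η) dμ⁻(η) ≠ 0`, `h(b) = χ₁(σ b̂)⁻¹` (`b` a unit; `0` otherwise)
— the hypothesis `hJ` of ★ p855477 `irregularReducibleCaseThree_of_skewLineIntegral_ne_zero`.  By transport along `R ≃ L_w` (evaluation at the unique `w ∣ v`) of ★ F5
`integral_skewLine_extend_ne_zero` (Tate's Fubini trick at `s = 0`).  [cite: Keys1984, §5; §7 Thm. (1) p. 126] [cite: Rogawski1990, §12.2 (3) pp. 173–174]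
[cite: CasselsFrohlichANT1967, Ch. II §10–§11; Ch. VII Prop. 1.2] -/
theorem skewLineIntegral_ne_zero (L : Type) [Field L] [NumberField L] [IsCMField L] (v : HeightOneSpectrum (𝓞 ↥(maximalRealSubfield L)))
    (hns : ∀ w : PlacesOver L v, IsCMField.complexConj L • w.1 = w.1)
    (χ₁ : (LocalRing L v)ˣ →* ℂˣ) (h₁ : Continuous (fun x => ((χ₁ x : ℂˣ) : ℂ)))
    (hnorm : ∀ α : (LocalRing L v)ˣ, χ₁ (Units.map (conjLocal L (IsCMField.complexConj L) v : LocalRing L v →* LocalRing L v) α) * χ₁ α = 1)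
    (hex : ∃ a : (LocalRing L v)ˣ, (conjLocal L (IsCMField.complexConj L) v) (a : LocalRing L v) = a ∧ χ₁ a ≠ 1)
    [MeasurableSpace (LocalRing L v)] [BorelSpace (LocalRing L v)]
    (μY : Measure ↥(HeisRing.skewPart (conjLocal L (IsCMField.complexConj L) v))) [μY.IsAddHaarMeasure] [μY.Regular] :
    ∫ η : ↥(HeisRing.skewPart (conjLocal L (IsCMField.complexConj L) v)),
      ((∏ w' : PlacesOver L v, normAbs (w'.1.adicCompletion L) ((1 + (η : LocalRing L v)) w'))⁻¹ : ℝ≥0) •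
        (fun b : LocalRing L v => if hb : IsUnit b then
          (((χ₁ (Units.map (conjLocal L (IsCMField.complexConj L) v : LocalRing L v →* LocalRing L v) hb.unit))⁻¹ : ℂˣ) : ℂ) else 0)
          (1 + (η : LocalRing L v)) ∂μY ≠ 0 := by
  classical
  ------------------------------------------------------------------ the unique place `w ∣ v` and the field `K = L_w`
  obtain ⟨w⟩ : Nonempty (PlacesOver L v) := inferInstance
  have hw := hns w
  haveI : Algebra.IsQuadraticExtension ↥(maximalRealSubfield L) L := IsCMField.isQuadraticExtension L
  haveI : Subsingleton (PlacesOver L v) :=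
    PlacesOver.subsingleton_of_smul_eq (IsCMField.complexConj L) (IsCMField.complexConj_ne_one L) w hw
  letI : Unique (PlacesOver L v) := uniqueOfSubsingleton w
  letI : MeasurableSpace (w.1.adicCompletion L) := borel _
  haveI : BorelSpace (w.1.adicCompletion L) := ⟨rfl⟩
  haveI : T2Space (w.1.adicCompletion L) :=
    (Literature.NumberTheory.GaloisRepresentations.IsNonarchimedeanLocalField.isLocalField (w.1.adicCompletion L)).toT2Space
  haveI : SecondCountableTopology (w.1.adicCompletion L) := secondCountableTopology_localField (w.1.adicCompletion L)
  letI : Invertible (2 : w.1.adicCompletion L) := invertibleOfNonzero two_ne_zero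
  -- abbreviations
  set σK : w.1.adicCompletion L →+* w.1.adicCompletion L := galAdicCompletionMap (L := L) (IsCMField.complexConj L) hw with hσKdef
  set eR : LocalRing L v ≃+* w.1.adicCompletion L := RingEquiv.piUnique (fun w' : PlacesOver L v => w'.1.adicCompletion L) with heRdef
  set eH : LocalRing L v ≃ₜ w.1.adicCompletion L := Homeomorph.piUnique (fun w' : PlacesOver L v => w'.1.adicCompletion L) with heHdef
  have heR : ∀ x : LocalRing L v, eR x = x w := fun x => rfl
  have heRsymm : ∀ y : w.1.adicCompletion L, (eR.symm y) w = y := fun y => by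
    show eR (eR.symm y) = y; exact eR.apply_symm_apply y
  have hcont_e : Continuous (eR : LocalRing L v → w.1.adicCompletion L) := eH.continuous
  have hcont_esymm : Continuous (eR.symm : w.1.adicCompletion L → LocalRing L v) := eH.symm.continuous
  -- `σ` read at `w`
  have hσw : ∀ x : LocalRing L v, (conjLocal L (IsCMField.complexConj L) v) x w = σK (x w) := fun x =>
    conjLocal_apply_eq_of_smul_eq (IsCMField.complexConj L) (IsCMField.complexConj_ne_one L) v w hw x
  have hσRR : ∀ x : LocalRing L v, (conjLocal L (IsCMField.complexConj L) v) ((conjLocal L (IsCMField.complexConj L) v) x) = x := conjLocal_conjLocal_cm L v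
  have hσK_e : ∀ y : w.1.adicCompletion L, σK y = (conjLocal L (IsCMField.complexConj L) v) (eR.symm y) w := fun y => by rw [hσw, heRsymm]
  have hσRsymm : ∀ y : w.1.adicCompletion L, (conjLocal L (IsCMField.complexConj L) v) (eR.symm y) = eR.symm (σK y) := by
    intro y
    apply eR.injective
    rw [RingEquiv.apply_symm_apply, heR, hσK_e]
  have hσK : ∀ y : w.1.adicCompletion L, σK (σK y) = y := by
    intro y
    rw [hσK_e y, ← hσw, hσRR, heRsymm]
  have hσKc : Continuous σK := continuous_galAdicCompletionMap L (IsCMField.complexConj L) hw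
  have hσKn : ∀ y : w.1.adicCompletion L, normAbs (w.1.adicCompletion L) (σK y) = normAbs (w.1.adicCompletion L) y := by
    intro y
    rw [hσK_e, ← prod_normAbs_eq_normAbs_apply L v w hw, prod_normAbs_conjLocal L v w hw, prod_normAbs_eq_normAbs_apply L v w hw, heRsymm]
  -- a skew unit, a fixed unit moving `χ₁`, the additive character
  obtain ⟨δR, hδR⟩ := exists_conjLocal_skew_unit L v
  set δK : (w.1.adicCompletion L)ˣ := Units.map (eR : LocalRing L v →* w.1.adicCompletion L) δR with hδKdef
  have hδK : σK (δK : w.1.adicCompletion L) = -δK := by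
    show σK (eR (δR : LocalRing L v)) = -eR (δR : LocalRing L v)
    rw [heR, ← hσw, hδR, Pi.neg_apply]
  obtain ⟨a, ha, hχa⟩ := hex
  set c₀ : (w.1.adicCompletion L)ˣ := Units.map (eR : LocalRing L v →* w.1.adicCompletion L) a with hc₀def
  have hc₀ : σK (c₀ : w.1.adicCompletion L) = c₀ := by
    show σK (eR (a : LocalRing L v)) = eR (a : LocalRing L v)
    rw [heR, ← hσw, ha]
  -- the quasi-character `χ = χ₁ ∘ Units.map e⁻¹` of `L_wˣ`
  have hmapc : Continuous (Units.map (eR.symm : w.1.adicCompletion L →* LocalRing L v)) := Continuous.units_map _ hcont_esymm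
  set χ : QuasiChar (w.1.adicCompletion L) :=
    { toMonoidHom := χ₁.comp (Units.map (eR.symm : w.1.adicCompletion L →* LocalRing L v))
      continuous_toFun := by
        refine Units.continuous_iff.2 ⟨h₁.comp hmapc, ?_⟩
        refine ((h₁.comp continuous_inv).comp hmapc).congr fun u => ?_
        simp only [Function.comp_apply, map_inv]
        rfl } with hχdef
  have hχapply : ∀ u : (w.1.adicCompletion L)ˣ, χ u = χ₁ (Units.map (eR.symm : w.1.adicCompletion L →* LocalRing L v) u) := fun u => rfl
  have hmapσ : ∀ u : (w.1.adicCompletion L)ˣ, Units.map (eR.symm : w.1.adicCompletion L →* LocalRing L v) (Units.map (σK : w.1.adicCompletion L →* w.1.adicCompletion L) u) =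
      Units.map ((conjLocal L (IsCMField.complexConj L) v) : LocalRing L v →* LocalRing L v) (Units.map (eR.symm : w.1.adicCompletion L →* LocalRing L v) u) := by
    intro u
    apply Units.ext
    simp only [Units.coe_map, MonoidHom.coe_coe]
    exact (hσRsymm (u : w.1.adicCompletion L)).symm
  have hχσ : ∀ u : (w.1.adicCompletion L)ˣ, χ (Units.map (σK : w.1.adicCompletion L →* w.1.adicCompletion L) u) * χ u = 1 := by
    intro u
    rw [hχapply, hχapply, hmapσ]
    exact hnorm _
  have hmap_c₀ : Units.map (eR.symm : w.1.adicCompletion L →* LocalRing L v) c₀ = a := by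
    apply Units.ext
    simp only [hc₀def, Units.coe_map, MonoidHom.coe_coe, RingEquiv.symm_apply_apply]
  have hχc₀ : χ c₀ ≠ 1 := by rw [hχapply, hmap_c₀]; exact hχa
  ------------------------------------------------------------------ the skew parts and the measures
  have hskew_to : ∀ η : ↥(HeisRing.skewPart (conjLocal L (IsCMField.complexConj L) v)), σK (eR (η : LocalRing L v)) = -eR (η : LocalRing L v) := by
    intro η
    rw [heR, ← hσw, (HeisRing.mem_skewPart_iff (conjLocal L (IsCMField.complexConj L) v) _).1 η.2, Pi.neg_apply]
  have hskew_from : ∀ y : ↥(HeisRing.skewPart σK), (conjLocal L (IsCMField.complexConj L) v) (eR.symm (y : w.1.adicCompletion L)) = -eR.symm (y : w.1.adicCompletion L) := by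
    intro y
    rw [hσRsymm, (HeisRing.mem_skewPart_iff σK _).1 y.2, map_neg]
  set eS : ↥(HeisRing.skewPart (conjLocal L (IsCMField.complexConj L) v)) ≃ₜ+ ↥(HeisRing.skewPart σK) :=
    { toFun := fun η => ⟨eR (η : LocalRing L v), (HeisRing.mem_skewPart_iff σK _).2 (hskew_to η)⟩
      invFun := fun y => ⟨eR.symm (y : w.1.adicCompletion L), (HeisRing.mem_skewPart_iff (conjLocal L (IsCMField.complexConj L) v) _).2 (hskew_from y)⟩
      left_inv := fun η => Subtype.ext (eR.symm_apply_apply _)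
      right_inv := fun y => Subtype.ext (eR.apply_symm_apply _)
      map_add' := fun η η' => Subtype.ext (by simp only [AddSubgroup.coe_add, map_add])
      continuous_toFun := (hcont_e.comp continuous_subtype_val).subtype_mk _
      continuous_invFun := (hcont_esymm.comp continuous_subtype_val).subtype_mk _ } with heSdef
  have heS : ∀ η : ↥(HeisRing.skewPart (conjLocal L (IsCMField.complexConj L) v)), ((eS η : ↥(HeisRing.skewPart σK)) : w.1.adicCompletion L) = (η : LocalRing L v) w := fun η => rfl
  haveI := HeisRing.locallyCompactSpace_skewPart (conjLocal L (IsCMField.complexConj L) v) (continuous_conjLocal L (IsCMField.complexConj L) v)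
  haveI := HeisRing.locallyCompactSpace_skewPart σK hσKc
  set μK : Measure ↥(HeisRing.skewPart σK) := μY.map eS with hμKdef
  haveI : μK.IsAddHaarMeasure := ContinuousAddEquiv.isAddHaarMeasure_map μY eS
  haveI : μK.Regular := Measure.Regular.map eS.toHomeomorph
  ------------------------------------------------------------------ ★ F5 on `L_w`, and the transfer of the integral
  have hK := integral_skewLine_extend_ne_zero σK hσK hσKc hσKn δK hδK (adeleAddCharAt L w.1) (isContinuousNontrivial_adeleAddCharAt L w.1)
    χ hχσ c₀ hc₀ hχc₀ μK
  -- the two integrands agree along `eS`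
  have hpt : ∀ η : ↥(HeisRing.skewPart (conjLocal L (IsCMField.complexConj L) v)),
      (((normAbs (w.1.adicCompletion L) (1 + ((eS η : ↥(HeisRing.skewPart σK)) : w.1.adicCompletion L)))⁻¹ : ℝ≥0)) •
          Function.extend ((↑) : (w.1.adicCompletion L)ˣ → w.1.adicCompletion L) (fun u => ((χ u : ℂˣ) : ℂ)) 0
            (1 + ((eS η : ↥(HeisRing.skewPart σK)) : w.1.adicCompletion L)) =
        ((∏ w' : PlacesOver L v, normAbs (w'.1.adicCompletion L) ((1 + (η : LocalRing L v)) w'))⁻¹ : ℝ≥0) •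
          (fun b : LocalRing L v => if hb : IsUnit b then
            (((χ₁ (Units.map (conjLocal L (IsCMField.complexConj L) v : LocalRing L v →* LocalRing L v) hb.unit))⁻¹ : ℂˣ) : ℂ) else 0)
            (1 + (η : LocalRing L v)) := by
    intro η
    have hb : IsUnit (1 + (η : LocalRing L v)) := isUnit_one_add_coe_skewPart L v w hw η
    have h1w : (1 + ((eS η : ↥(HeisRing.skewPart σK)) : w.1.adicCompletion L)) = eR (1 + (η : LocalRing L v)) := by
      rw [heS, map_add, map_one, heR]
    have hne : eR (1 + (η : LocalRing L v)) ≠ 0 := fun h0 =>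
      (isUnit_iff_ne_zero_localRing L v w hw _).1 hb (eR.injective (by rw [h0, map_zero]))
    have hunit : Units.map (eR.symm : w.1.adicCompletion L →* LocalRing L v) (Units.mk0 _ hne) = hb.unit := by
      apply Units.ext
      simp only [Units.coe_map, MonoidHom.coe_coe, Units.val_mk0, RingEquiv.symm_apply_apply, IsUnit.unit_spec]
    have hnormw : normAbs (w.1.adicCompletion L) (eR (1 + (η : LocalRing L v))) =
        ∏ w' : PlacesOver L v, normAbs (w'.1.adicCompletion L) ((1 + (η : LocalRing L v)) w') := by
      rw [heR, prod_normAbs_eq_normAbs_apply L v w hw]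
    have hinv : (((χ₁ (Units.map (conjLocal L (IsCMField.complexConj L) v : LocalRing L v →* LocalRing L v) hb.unit))⁻¹ : ℂˣ) : ℂ) =
        ((χ₁ hb.unit : ℂˣ) : ℂ) := by
      rw [inv_eq_of_mul_eq_one_right (hnorm hb.unit)]
    rw [h1w, hnormw, extend_apply_of_ne_zero χ hne, hχapply, hunit]
    simp only [hb, dite_true, hinv]
  have hmap : ∫ y, (((normAbs (w.1.adicCompletion L) (1 + ((y : ↥(HeisRing.skewPart σK)) : w.1.adicCompletion L)))⁻¹ : ℝ≥0)) •
        Function.extend ((↑) : (w.1.adicCompletion L)ˣ → w.1.adicCompletion L) (fun u => ((χ u : ℂˣ) : ℂ)) 0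
          (1 + ((y : ↥(HeisRing.skewPart σK)) : w.1.adicCompletion L)) ∂μK =
      ∫ η, (((normAbs (w.1.adicCompletion L) (1 + ((eS η : ↥(HeisRing.skewPart σK)) : w.1.adicCompletion L)))⁻¹ : ℝ≥0)) •
        Function.extend ((↑) : (w.1.adicCompletion L)ˣ → w.1.adicCompletion L) (fun u => ((χ u : ℂˣ) : ℂ)) 0
          (1 + ((eS η : ↥(HeisRing.skewPart σK)) : w.1.adicCompletion L)) ∂μY := by
    rw [hμKdef]
    exact integral_map_equiv eS.toHomeomorph.toMeasurableEquiv _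
  rw [hmap] at hK
  simp_rw [hpt] at hK
  beta_reduce
  exact hK

end Summit.HodgeConjecture.HodgeConjecture.Cruxes.H413.K2E3KeysSkewLineNonvanishingCM

end
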